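import Literature.NumberTheory.EllipticCurves.GlobalMinimalModel
import Literature.NumberTheory.EllipticCurves.ModularCurve
import Mathlib.Algebra.Module.ZLattice.Covolume
import HarnessLib

/-!
# Silverman 1986: the Faltings height controls `|Δ_min|` and `|c₄|³` — covolume form

Topic `Literature/NumberTheory/EllipticCurves`; ONE named fact (result in print, `def … : Prop`,
D-0014) requested by route `ABC/RibetTakahashiSplit`, support item `stmt-ABC-1566`
(`CovolumeSzpiroBound`, hypothesis no. 5 of that route's Assembly: "alternatively land as a
cite-tagged Literature fact").

J. H. Silverman, *Heights and elliptic curves*, in: Arithmetic Geometry (Cornell–Silverman eds.),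
Springer 1986, Ch. X (held; read pp. 330–334 of the volume):

* **Proposition 1.1** (p. 330; `K = ℚ`): `12 h(E/ℚ) = log |Δ_{E/ℚ}| − log(|Δ(τ)| (Im τ)⁶)`,
  where `E(ℂ) ≅ ℂ/(ℤ + ℤτ)` and `Δ_{E/ℚ}` is the minimal discriminant. If `Λ = ω₁(ℤ + ℤτ)` is the
  Néron lattice of a global minimal model (the lattice of its invariant differential, so that the
  lattice discriminant `g₂(Λ)³ − 27 g₃(Λ)² = (c₄/12)³ − 27(c₆/216)² = Δ_min`), homogeneity of the
  discriminant gives `|Δ_min| = |ω₁|^{−12} · C · |Δ(τ)|` with an absolute constant `C`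
  (Silverman's normalisation of `Δ(τ)`), hence
  `12 h(E/ℚ) = −6 log covol(Λ) + log C`, `covol(Λ) = |ω₁|² Im τ` — the Faltings height IS
  `−½ log covol(Λ_Néron)` up to an absolute additive constant (his Remark 1.2 (4)).
* **Corollary 2.3** (p. 334): for `E/ℚ` with a minimal Weierstrass equation and associated
  `Δ, c₄, c₆ ∈ ℤ`, for any `ε > 0`,
  `h(E/ℚ) + O(1) ≤ (1/12) log max{|Δ|, |Δ j|} ≤ (1 + ε) h(E/ℚ) + O_ε(1)` and
  `h(E/ℚ) + O(1) ≤ (1/12) log max{|c₄|³, |c₆|²} ≤ (1 + ε) h(E/ℚ) + O_ε(1)`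
  (`Δ j = c₄³`; absolute `O(1)`, `O_ε(1)` depending only on `ε`).

Combining the right-hand inequalities with Prop. 1.1:
`log max{|Δ|, |c₄|³} ≤ 12(1+ε) h + O_ε(1) = −6(1+ε) log covol(Λ) + O_ε(1)`, i.e.
`max(|Δ_min|, |c₄|³) ≤ A_ε · covol(Λ)^{−6−6ε}` — the fact below (with `6ε` renamed `ε`).

## Rendering

* `W : WeierstrassCurve ℚ`, elliptic and globally minimal (`IsGloballyMinimal`, so `W.Δ = Δ_min`
  and `c₄(W)` is the `c₄` of a minimal equation, as in Cor. 2.3);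
* `L : PeriodPair` with `IsNeronLatticeOf (W.baseChange ℂ) L` (`g₂(L) = c₄/12`, `g₃(L) = c₆/216`:
  the Néron lattice, `ModularCurve.lean`), `covol = ZLattice.covolume L.lattice`;
* the bound is stated exactly as the route item `CovolumeSzpiroBound` consumes it
  (item = fact, by `exact`). The companion bound for `|c₆|²` (second display of Cor. 2.3) is
  included as a separate conjunct-free fact `silverman1986_c6_covolume` for completeness.

## References

* J. H. Silverman, *Heights and elliptic curves*, in G. Cornell, J. H. Silverman (eds.),
  Arithmetic Geometry, Springer (1986) 253–265: Prop. 1.1, Remark 1.2, Prop. 2.1, Cor. 2.3.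
  [Silverman1986] (held: book:cornellnd-arithmetic-geometry pp. 330–334, read.)
* J. H. Silverman, *The Arithmetic of Elliptic Curves*, 2nd ed. (2009), VI.3.6, VI.5.1 (the
  lattice of the invariant differential), VIII.8 (global minimal models). [SilvermanAEC2009]
-/

noncomputable section

namespace Literature.NumberTheory.EllipticCurves.ModularForms

/-- **Silverman 1986, Cor. 2.3 with Prop. 1.1 (covolume form).** For every `ε > 0` there is
`A = A_ε` such that for every elliptic curve `W/ℚ` given by a GLOBAL MINIMAL Weierstrass equation
and every period pair `L` spanning its Néron lattice (`IsNeronLatticeOf (W.baseChange ℂ) L`),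
`max(|Δ_W|, |c₄(W)|³) ≤ A · covol(L.lattice)^{−(6+ε)}`.
Printed form: `(1/12) log max{|Δ|, |Δj|}, (1/12) log max{|c₄|³, |c₆|²} ≤ (1+ε) h(E/ℚ) + O_ε(1)`
(Cor. 2.3) and `12 h(E/ℚ) = log|Δ_min| − log(|Δ(τ)|(Im τ)⁶) = −6 log covol(Λ_Néron) + O(1)`
(Prop. 1.1; module docstring). Since `h(E/ℚ) ≥ −O(1)` the covolume is bounded above, so the
statement is only about small covolumes. Grounds `Summit.ABC.ABC.Theses.RibetTakahashiSplit.CovolumeSzpiroBound`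
(verbatim). [cite: Silverman1986, Cor. 2.3 with Prop. 1.1 (Arithmetic Geometry pp. 330, 334)] -/
def silverman1986_discriminant_c4_covolume : Prop :=
  ∀ ε : ℝ, 0 < ε → ∃ A : ℝ, ∀ (W : WeierstrassCurve ℚ) [W.IsElliptic] [W.IsGloballyMinimal]
    (L : PeriodPair), IsNeronLatticeOf (W.baseChange ℂ) L →
      ((max |W.Δ| (|W.c₄| ^ 3) : ℚ) : ℝ) ≤ A * ZLattice.covolume L.lattice ^ (-(6 + ε))

/-- **Silverman 1986, Cor. 2.3, second display, with Prop. 1.1 (covolume form)**: under the same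
hypotheses `|c₆(W)|² ≤ A_ε · covol(L.lattice)^{−(6+ε)}` (from
`(1/12) log max{|c₄|³, |c₆|²} ≤ (1+ε) h(E/ℚ) + O_ε(1)`). [cite: Silverman1986, Cor. 2.3 (second display) with Prop. 1.1] -/
def silverman1986_c6_covolume : Prop :=
  ∀ ε : ℝ, 0 < ε → ∃ A : ℝ, ∀ (W : WeierstrassCurve ℚ) [W.IsElliptic] [W.IsGloballyMinimal]
    (L : PeriodPair), IsNeronLatticeOf (W.baseChange ℂ) L →
      ((|W.c₆| ^ 2 : ℚ) : ℝ) ≤ A * ZLattice.covolume L.lattice ^ (-(6 + ε))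

end Literature.NumberTheory.EllipticCurves.ModularForms

end
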